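import Summits.HodgeConjecture.CorCM.GaloisRealFactorComplement
import Summits.HodgeConjecture.CorCM.GaloisDegenerateCoprimeQuotient
import Summits.HodgeConjecture.CorCM.GaloisPrimitiveTypeCount
import Mathlib.GroupTheory.Sylow
import HarnessLib

/-!
# A NORMAL HALL SUBGROUP OF ODD ORDER in the Galois group of a GOOD Galois CM field is trivial or of prime order;
# a normal Sylow `p`-subgroup (`p` odd) has order `≤ p`, and two odd primes cannot both have non-trivial normal Sylow subgroups

COR-CM (cell `pub-hodgecm2`), binder seat b04 (gen 38), count-neutral own lane «Galois-CM-type classification».  KERNEL ONLY: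
theorems; no definition, no named fact, no `sorry`.  `HC_CM` is neither used nor claimed.

`K` a Galois CM field, `G = Gal(K/ℚ)`, `c` complex conjugation; GOOD = every primitive CM type nondegenerate (the Hodge ring of every
power of every simple abelian variety with CM by `K` is generated by divisor classes), BAD = a simple CM abelian variety of dimension
`[K:ℚ]/2` with an exceptional Hodge class on a power.  Let `N ◁ G` have ODD order prime to its index (a normal Hall subgroup; `c ∉ N`).
By SCHUR–ZASSENHAUS `N` has a complement `Γ'`, which contains `c` (gen 31 `GaloisModels.mem_complement_of_odd`); `Γ' ≅ Gal(K^N/ℚ)`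
carries a PRIMITIVE CM SET as soon as `[G:N] ≥ 14` (gen 38 `PrimitiveCount.exists_primitive_cm_subgroup_of_card_ge`); and gen 24's
theorem «a totally real factor is fatal» (`Complement.exists_simple_degenerate_of_complement`: the fixed field `M = K^{Γ'}` is a totally
real field with `K = M · K^N` linearly disjoint) makes `K` BAD unless `N ∈ {1, C₂, C₂², C₂³, C₄, C_p, S₃}` — for odd `|N|`: unless
`|N| = 1` or `|N|` is prime.

* **`exists_simple_degenerate_of_normal_hall_odd`** — `|N|` odd, `gcd(|N|, [G:N]) = 1`, `[G:N] ≥ 14`, `|N| ≠ 1` not prime ⟹ BAD;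
  `card_eq_one_or_prime_of_normal_hall_odd` — GOOD ⟹ `|N| = 1` or `|N|` prime.
* **`card_sylow_le_of_normal`** — a NORMAL Sylow `p`-subgroup `P` (`p` odd, `[G:P] ≥ 14`) of a GOOD field has `|P| ∈ {1, p}`: the
  `p`-part of `[K:ℚ]` is at most `p`.
* **`exists_simple_degenerate_of_two_normal_sylow`** — normal Sylow subgroups `P ≠ 1 ≠ Q` for two distinct odd primes with
  `[G : PQ] ≥ 14` ⟹ BAD (`PQ` is a normal Hall subgroup of composite order `|P||Q|`); `GOOD` form `sylow_eq_bot_or_of_normal`.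
With gen 38's `CorCM/GaloisNormalSylow` (Sylow `p`-subgroups of GOOD fields ARE normal for odd `p` under gen 33's size condition, and
unconditionally for `p ≥ 31`) this yields the structure of the odd part: `CorCM/GaloisOddPartStructure`.

## References

* [Shimura1998] G. Shimura, *Abelian Varieties with Complex Multiplication and Modular Functions*, §6.2 Thm. 3, §8.2 Prop. 26, §8.4.
* [Gordon1999HodgeAVSurvey] B. B. Gordon, *A survey of the Hodge conjecture for abelian varieties*, Thm. 6.4, §9.3.
* [Dodson1984] B. Dodson, *The structure of Galois groups of CM-fields*, Trans. AMS 283 (1984), §3.1.1, §4.1.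
* [Rotman1995] J. J. Rotman, *An Introduction to the Theory of Groups*, 4th ed., GTM 148, Thm. 7.41 (Schur–Zassenhaus), Thm. 4.12.
-/

noncomputable section

open CategoryTheory CategoryTheory.Limits NumberField
open scoped BigOperators Pointwise

namespace Summit.HodgeConjecture.CorCM.GaloisModels

open Literature.NumberTheory.ComplexMultiplication
open Literature.AlgebraicGeometry.Motives (AbelianVariety CMType)
open Literature.AlgebraicGeometry.HodgeTheory
open Literature.AlgebraicGeometry.ComplexMultiplication (IsCMTypeRealisation)
open Literature.AlgebraicGeometry.Pohlmann1968
open Literature.Barriers.HodgeConjecture (divisorClassesSpan)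
open Summit.HodgeConjecture.CorCM.GaloisRank
open Summit.HodgeConjecture.CorCM.GaloisOctic (complexConj_mul_comm complexConj_mul_self)
open Summit.HodgeConjecture.CorCM.Complement (exists_simple_degenerate_of_complement)
open Summit.HodgeConjecture.CorCM.GaloisModels.PrimitiveCount (exists_primitive_cm_subgroup_of_card_ge)

/-! ## §0 The order of `H₁ ⊔ H₂` for a normal `H₁` of order prime to `|H₂|` -/

section Group

variable {G : Type*} [Group G] [Finite G]

/-- `|H₁ ⊔ H₂| = |H₁| · |H₂|` for `H₁ ◁ G` and `gcd(|H₁|, |H₂|) = 1` (`H₁ ⊔ H₂ = H₁H₂` as a set, and `|H₁|, |H₂|` both divide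
`|H₁ ⊔ H₂|`). [cite: Rotman1995, Thm. 2.20 and Thm. 4.12] -/
theorem card_sup_eq_mul_of_coprime (H₁ H₂ : Subgroup G) [H₁.Normal] (hcop : Nat.Coprime (Nat.card H₁) (Nat.card H₂)) :
    Nat.card (H₁ ⊔ H₂ : Subgroup G) = Nat.card H₁ * Nat.card H₂ := by
  classical
  have hdvd : Nat.card H₁ * Nat.card H₂ ∣ Nat.card (H₁ ⊔ H₂ : Subgroup G) :=
    Nat.Coprime.mul_dvd_of_dvd_of_dvd hcop (Subgroup.card_dvd_of_le le_sup_left) (Subgroup.card_dvd_of_le le_sup_right)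
  have hle : Nat.card (H₁ ⊔ H₂ : Subgroup G) ≤ Nat.card H₁ * Nat.card H₂ := by
    have h := Subgroup.normal_mul H₁ H₂
    have e : Nat.card (H₁ ⊔ H₂ : Subgroup G) = Nat.card (↥((H₁ : Set G) * (H₂ : Set G))) := by
      rw [← h]
      rfl
    rw [e]
    exact Set.natCard_mul_le
  exact le_antisymm hle (Nat.le_of_dvd Nat.card_pos hdvd)

end Group

variable {K : Type} [Field K] [NumberField K] [IsCMField K] [IsGalois ℚ K]

/-! ## §1 Normal Hall subgroups of odd order -/

/-- **A NORMAL HALL SUBGROUP OF ODD COMPOSITE ORDER IS FATAL.**  `K` Galois CM, `N ◁ Gal(K/ℚ)` with `|N|` odd, `gcd(|N|, [Gal:N]) = 1`,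
`[Gal:N] ≥ 14`, `|N| ≠ 1` and `|N|` not prime ⟹ `K` carries a SIMPLE DEGENERATE abelian variety of dimension `[K:ℚ]/2` with CM by `K`
(a rational `(p,p)` class outside the divisor ring on some power).  Schur–Zassenhaus gives a complement `Γ' ∋ c`, counting gives a
primitive CM set of `(Γ', c)`, and the totally real field `K^{Γ'}` is a fatal real factor (gen 24).
[cite: Shimura1998, §6.2 Thm. 3 and §8.2 Prop. 26] [cite: Gordon1999HodgeAVSurvey, Thm. 6.4 and §9.3] [cite: Dodson1984, §3.1.1 and §4.1]
[cite: Rotman1995, Thm. 7.41] -/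
theorem exists_simple_degenerate_of_normal_hall_odd (N : Subgroup (K ≃ₐ[ℚ] K)) [N.Normal] (hodd : Odd (Nat.card N))
    (hcop : Nat.Coprime (Nat.card N) N.index) (hidx : 14 ≤ N.index) (hN1 : Nat.card N ≠ 1) (hNp : ¬ (Nat.card N).Prime) :
    ∃ (Φ : CMType K) (φ : K →+* ℂ) (X : AbelianVariety ℂ) (ι : 𝓞 K →+* End X)
      (ϑ : K →+* Module.End ℂ (complexBetti X.X 1)),
      IsPrimitive (ℂ ≃+* ℂ) Φ.1 φ ∧ ¬ IsNondegenerate Φ ∧ IsCMTypeRealisation Φ X ι ϑ ∧ X.IsSimple ∧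
      X.dim = Module.finrank ℚ K / 2 ∧
      ∃ n p : ℕ, ∃ x : complexBetti (⨁ fun _ : Fin n => X).X (2 * p), IsRationalClass x ∧
        IsOfHodgeType (⨁ fun _ : Fin n => X).dim (⨁ fun _ : Fin n => X).X (2 * p) p p x ∧
        x ∉ divisorClassesSpan (⨁ fun _ : Fin n => X).X (⨁ fun _ : Fin n => X).dim p := by
  classical
  set c : K ≃ₐ[ℚ] K := (IsCMField.complexConj K).restrictScalars ℚ with hc_def
  have hcz : ∀ g : K ≃ₐ[ℚ] K, c * g = g * c := fun g => complexConj_mul_comm g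
  have hcc : c * c = 1 := complexConj_mul_self
  have hc1 : c ≠ 1 := model_complexConj_ne_one (MulEquiv.refl _) rfl
  -- Schur–Zassenhaus: a complement `Γ'`, which contains `c`
  obtain ⟨Γ', hNΓ⟩ := Subgroup.exists_right_complement'_of_coprime hcop
  have hcΓ : c ∈ Γ' := mem_complement_of_odd hNΓ hodd hcz hcc
  have hdisj : ∀ g, g ∈ N → g ∈ Γ' → g = 1 := fun g hgN hgΓ => by
    have := hNΓ.disjoint
    rw [Subgroup.disjoint_def] at this
    exact this hgN hgΓ
  have hprod : ∀ g : K ≃ₐ[ℚ] K, ∃ q ∈ N, ∃ γ ∈ Γ', g = q * γ := fun g => by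
    obtain ⟨⟨n, γ⟩, hnγ, -⟩ := Subgroup.isComplement'_def.1 hNΓ |>.existsUnique g
    exact ⟨n, n.2, γ, γ.2, hnγ.symm⟩
  -- a primitive CM set of `(Γ', c)`: `|Γ'| = [Gal:N] ≥ 14`
  have hcardΓ : Nat.card Γ' = N.index := (hNΓ.symm.index_eq_card).symm
  obtain ⟨F, hFcm, hFprim⟩ := exists_primitive_cm_subgroup_of_card_ge Γ' hcΓ (fun g _ => hcz g) hcc hc1
    (by rw [hcardΓ]; exact hidx)
  -- `N ∉ {1, C₂, C₂², C₂³, C₄, C_p, S₃}`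
  refine exists_simple_degenerate_of_complement N Γ' hdisj hprod hcΓ F hFcm hFprim ?_ ?_ hNp ?_
  · intro hexp
    exfalso
    obtain ⟨h, hhN, hh1⟩ : ∃ h ∈ N, h ≠ 1 := by
      by_contra hall
      push Not at hall
      exact hN1 ((Subgroup.eq_bot_iff_card N).1 ((Subgroup.eq_bot_iff_forall N).2 hall))
    have h2 : orderOf h = 2 := orderOf_eq_prime (by rw [pow_two]; exact hexp h hhN) hh1
    have hdvd : 2 ∣ Nat.card N := by
      rw [← h2, ← Subgroup.orderOf_mk h hhN]
      exact orderOf_dvd_natCard (⟨h, hhN⟩ : N)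
    exact (Nat.not_even_iff_odd.2 hodd) (even_iff_two_dvd.2 hdvd)
  · intro h4
    rw [h4] at hodd
    exact absurd hodd (by decide)
  · intro h6
    rw [h6] at hodd
    exact absurd hodd (by decide)

/-- **GOOD ⟹ every normal Hall subgroup of odd order is trivial or of prime order** (`[Gal:N] ≥ 14`).
[cite: Shimura1998, §8.2 Prop. 26] [cite: Dodson1984, §3.1.1 and §4.1] [cite: Rotman1995, Thm. 7.41] -/
theorem card_eq_one_or_prime_of_normal_hall_odd (N : Subgroup (K ≃ₐ[ℚ] K)) [N.Normal] (hodd : Odd (Nat.card N))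
    (hcop : Nat.Coprime (Nat.card N) N.index) (hidx : 14 ≤ N.index)
    (hgood : ∀ (Φ : CMType K) (φ : K →+* ℂ), IsPrimitive (ℂ ≃+* ℂ) Φ.1 φ → IsNondegenerate Φ) :
    Nat.card N = 1 ∨ (Nat.card N).Prime := by
  by_contra h
  push Not at h
  obtain ⟨Φ, φ, X, ι, ϑ, H1, H2, -⟩ := exists_simple_degenerate_of_normal_hall_odd N hodd hcop hidx h.1 h.2
  exact H2 (hgood Φ φ H1)

/-! ## §2 Normal Sylow subgroups for odd primes -/

/-- **A NORMAL SYLOW `p`-SUBGROUP OF A GOOD FIELD HAS ORDER `≤ p`** (`p` odd, `[Gal:P] ≥ 14`): `|P| = 1` or `|P| = p` — the `p`-part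
of `[K:ℚ]` is at most `p`. [cite: Shimura1998, §8.2 Prop. 26] [cite: Dodson1984, §3.1.1 and §4.1] [cite: Rotman1995, Thm. 4.12 and Thm. 7.41] -/
theorem card_sylow_le_of_normal {p : ℕ} [hp : Fact p.Prime] (hp2 : p ≠ 2) (P : Sylow p (K ≃ₐ[ℚ] K))
    [hP : (P : Subgroup (K ≃ₐ[ℚ] K)).Normal] (hidx : 14 ≤ (P : Subgroup (K ≃ₐ[ℚ] K)).index)
    (hgood : ∀ (Φ : CMType K) (φ : K →+* ℂ), IsPrimitive (ℂ ≃+* ℂ) Φ.1 φ → IsNondegenerate Φ) :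
    Nat.card (P : Subgroup (K ≃ₐ[ℚ] K)) = 1 ∨ Nat.card (P : Subgroup (K ≃ₐ[ℚ] K)) = p := by
  classical
  obtain ⟨k, hk⟩ := P.isPGroup'.exists_card_eq
  have hodd : Odd (Nat.card (P : Subgroup (K ≃ₐ[ℚ] K))) := by
    rw [hk]
    exact (hp.out.odd_of_ne_two hp2).pow
  rcases card_eq_one_or_prime_of_normal_hall_odd (P : Subgroup (K ≃ₐ[ℚ] K)) hodd P.card_coprime_index hidx hgood with h | h
  · exact Or.inl h
  · right
    rw [hk] at h ⊢
    have hk0 : k ≠ 0 := by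
      rintro rfl
      rw [pow_zero] at h
      exact Nat.not_prime_one h
    rcases h.eq_one_or_self_of_dvd p (dvd_pow_self p hk0) with h1 | h1
    · exact absurd h1 hp.out.one_lt.ne'
    · exact h1.symm

/-- **TWO ODD PRIMES WITH NON-TRIVIAL NORMAL SYLOW SUBGROUPS ARE FATAL.**  `P ◁ Gal(K/ℚ)` a Sylow `p`-subgroup and `Q ◁ Gal(K/ℚ)` a
Sylow `q`-subgroup, `p ≠ q` odd primes, `P ≠ 1 ≠ Q`, `[Gal : PQ] ≥ 14` ⟹ `K` carries a SIMPLE DEGENERATE abelian variety of dimension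
`[K:ℚ]/2` (`PQ` is a normal Hall subgroup of the composite odd order `|P||Q|`). [cite: Shimura1998, §6.2 Thm. 3 and §8.2 Prop. 26]
[cite: Gordon1999HodgeAVSurvey, Thm. 6.4 and §9.3] [cite: Dodson1984, §3.1.1 and §4.1] [cite: Rotman1995, Thm. 4.12 and Thm. 7.41] -/
theorem exists_simple_degenerate_of_two_normal_sylow {p q : ℕ} [hp : Fact p.Prime] [hq : Fact q.Prime] (hp2 : p ≠ 2)
    (hq2 : q ≠ 2) (hpq : p ≠ q) (P : Sylow p (K ≃ₐ[ℚ] K)) (Q : Sylow q (K ≃ₐ[ℚ] K))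
    [hP : (P : Subgroup (K ≃ₐ[ℚ] K)).Normal] [hQ : (Q : Subgroup (K ≃ₐ[ℚ] K)).Normal]
    (hP1 : (P : Subgroup (K ≃ₐ[ℚ] K)) ≠ ⊥) (hQ1 : (Q : Subgroup (K ≃ₐ[ℚ] K)) ≠ ⊥)
    (hidx : 14 ≤ ((P : Subgroup (K ≃ₐ[ℚ] K)) ⊔ (Q : Subgroup (K ≃ₐ[ℚ] K))).index) :
    ∃ (Φ : CMType K) (φ : K →+* ℂ) (X : AbelianVariety ℂ) (ι : 𝓞 K →+* End X)
      (ϑ : K →+* Module.End ℂ (complexBetti X.X 1)),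
      IsPrimitive (ℂ ≃+* ℂ) Φ.1 φ ∧ ¬ IsNondegenerate Φ ∧ IsCMTypeRealisation Φ X ι ϑ ∧ X.IsSimple ∧
      X.dim = Module.finrank ℚ K / 2 ∧
      ∃ n p : ℕ, ∃ x : complexBetti (⨁ fun _ : Fin n => X).X (2 * p), IsRationalClass x ∧
        IsOfHodgeType (⨁ fun _ : Fin n => X).dim (⨁ fun _ : Fin n => X).X (2 * p) p p x ∧
        x ∉ divisorClassesSpan (⨁ fun _ : Fin n => X).X (⨁ fun _ : Fin n => X).dim p := by
  classical
  have hpp := hp.out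
  have hqq := hq.out
  set N : Subgroup (K ≃ₐ[ℚ] K) := (P : Subgroup (K ≃ₐ[ℚ] K)) ⊔ (Q : Subgroup (K ≃ₐ[ℚ] K)) with hN
  -- `|N| = |P| |Q| = p^a q^b`
  obtain ⟨a, ha⟩ := P.isPGroup'.exists_card_eq
  obtain ⟨b, hb⟩ := Q.isPGroup'.exists_card_eq
  have ha0 : a ≠ 0 := by
    rintro rfl
    rw [pow_zero] at ha
    exact hP1 ((Subgroup.eq_bot_iff_card _).2 ha)
  have hb0 : b ≠ 0 := by
    rintro rfl
    rw [pow_zero] at hb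
    exact hQ1 ((Subgroup.eq_bot_iff_card _).2 hb)
  have hcopPQ : Nat.Coprime (Nat.card (P : Subgroup (K ≃ₐ[ℚ] K))) (Nat.card (Q : Subgroup (K ≃ₐ[ℚ] K))) := by
    rw [ha, hb]
    exact Nat.Coprime.pow _ _ ((Nat.coprime_primes hpp hqq).2 hpq)
  have hcardN : Nat.card N = p ^ a * q ^ b := by
    rw [← ha, ← hb]
    exact card_sup_eq_mul_of_coprime _ _ hcopPQ
  -- the hypotheses of §1
  have hodd : Odd (Nat.card N) := by
    rw [hcardN]
    exact ((hpp.odd_of_ne_two hp2).pow).mul ((hqq.odd_of_ne_two hq2).pow)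
  have hpi : ¬ p ∣ N.index := fun h => P.not_dvd_index (h.trans (Subgroup.index_dvd_of_le le_sup_left))
  have hqi : ¬ q ∣ N.index := fun h => Q.not_dvd_index (h.trans (Subgroup.index_dvd_of_le le_sup_right))
  have hcop : Nat.Coprime (Nat.card N) N.index := by
    rw [hcardN]
    exact Nat.Coprime.mul_left (Nat.Coprime.pow_left _ ((Nat.Prime.coprime_iff_not_dvd hpp).2 hpi))
      (Nat.Coprime.pow_left _ ((Nat.Prime.coprime_iff_not_dvd hqq).2 hqi))
  have hN1 : Nat.card N ≠ 1 := by
    rw [hcardN]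
    have h1 : 1 < p ^ a := Nat.one_lt_pow ha0 hpp.one_lt
    have h2 : 0 < q ^ b := pow_pos hqq.pos b
    exact Nat.ne_of_gt (lt_of_lt_of_le h1 (Nat.le_mul_of_pos_right _ h2))
  have hNp : ¬ (Nat.card N).Prime := by
    rw [hcardN]
    intro hpr
    have h1 : p ∣ p ^ a * q ^ b := (dvd_pow_self p ha0).mul_right _
    have h2 : q ∣ p ^ a * q ^ b := (dvd_pow_self q hb0).mul_left _
    rcases hpr.eq_one_or_self_of_dvd p h1 with h | h
    · exact hpp.one_lt.ne' h
    rcases hpr.eq_one_or_self_of_dvd q h2 with h' | h'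
    · exact hqq.one_lt.ne' h'
    exact hpq (h.trans h'.symm)
  exact exists_simple_degenerate_of_normal_hall_odd N hodd hcop hidx hN1 hNp

/-- **GOOD ⟹ at most one odd prime has a non-trivial normal Sylow subgroup** (for normal Sylow subgroups `P`, `Q` at distinct odd primes
with `[Gal : PQ] ≥ 14`: `P = 1` or `Q = 1`). [cite: Shimura1998, §8.2 Prop. 26] [cite: Dodson1984, §3.1.1 and §4.1]
[cite: Rotman1995, Thm. 4.12 and Thm. 7.41] -/
theorem sylow_eq_bot_or_of_normal {p q : ℕ} [Fact p.Prime] [Fact q.Prime] (hp2 : p ≠ 2) (hq2 : q ≠ 2) (hpq : p ≠ q)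
    (P : Sylow p (K ≃ₐ[ℚ] K)) (Q : Sylow q (K ≃ₐ[ℚ] K)) [(P : Subgroup (K ≃ₐ[ℚ] K)).Normal]
    [(Q : Subgroup (K ≃ₐ[ℚ] K)).Normal] (hidx : 14 ≤ ((P : Subgroup (K ≃ₐ[ℚ] K)) ⊔ (Q : Subgroup (K ≃ₐ[ℚ] K))).index)
    (hgood : ∀ (Φ : CMType K) (φ : K →+* ℂ), IsPrimitive (ℂ ≃+* ℂ) Φ.1 φ → IsNondegenerate Φ) :
    (P : Subgroup (K ≃ₐ[ℚ] K)) = ⊥ ∨ (Q : Subgroup (K ≃ₐ[ℚ] K)) = ⊥ := by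
  by_contra h
  push Not at h
  obtain ⟨Φ, φ, X, ι, ϑ, H1, H2, -⟩ := exists_simple_degenerate_of_two_normal_sylow hp2 hq2 hpq P Q h.1 h.2 hidx
  exact H2 (hgood Φ φ H1)

end Summit.HodgeConjecture.CorCM.GaloisModels

end
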